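import Literature.AlgebraicGeometry.Frobenioids.FrobeniusConjugates
import HarnessLib

/-!
# Frobenioids I, Proposition 2.1 (iii): descent along morphisms of Frobenius type (node id FrdI:Prop2.1(iii))

Mochizuki, *The geometry of Frobenioids I: the general theory*, Kyushu J. Math. **62** (2008),
§2, Proposition 2.1 (iii), kurims text pp. 44–45 [cite: MochizukiFrdI2008, Prop. 2.1(iii) p.44].
PROOF-ONLY file (no definition, no statement of the paper restated): the lemmas behind the proof of
Prop. 2.1 (iii) "`C` is of perfect type if and only if `Ψ` is an equivalence of categories", in the
form "morphisms DESCEND along pairs of morphisms of Frobenius type of the same degree".  The printed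
reduction (p. 44–45): "one may reduce to the case of linear morphisms by applying the existence and
(essential) uniqueness of morphisms of Frobenius type of a given Frobenius degree [Def. 1.3 (ii)]"
(`exists_frobeniusType_descent`); "by applying the equivalence of categories [involving pull-backs]
of Definition 1.3, (i), (c) [cf. also the isomorphism of functors appearing in the definition of a
pull-back morphism in Definition 1.2, (ii)], one may reduce further to the case of pre-steps"
(`exists_pullback_descent`, `pullback_descent_unique`); "the case of pre-steps follows immediately
from the definition of perfect [Def. 1.2 (iv)]" (`exists_descent` = fullness, `cancel_frobeniusType`
= faithfulness: in a Frobenioid of perfect type a morphism of Frobenius type is right-cancellable).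
The functor-level statements are in `NaiveFrobeniusFunctorProofs.lean`.  Inputs: Def. 1.3 (found,
`Frobenioid.lean`), Prop. 1.4 (v) / 1.7 (found, `CoAngular.lean`, `Composites.lean`), Prop. 1.10
(i)(ii) (seat abc-iut-L1-t1, `FrobeniusConjugates.lean`).  Composition is diagrammatic
(`f ≫ g` is the printed `g ∘ f`).
-/

namespace Literature.AlgebraicGeometry.Frobenioids

open CategoryTheory Opposite

universe w v v' u u'

namespace PreFrobenioid

variable {D : Type u} [Category.{v} D] {Φ : Dᵒᵖ ⥤ CommMonCat.{w}}
  {C : Type u'} [Category.{v'} C] {F : C ⥤ ElemFrobenioid Φ}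

/-! ### The lifting property of pull-back morphisms (Def. 1.2 (ii)) and Def. 1.3 (i)(c) -/

/-- The arrow provided by a pull-back morphism `φ : A → B` (Def. 1.2 (ii)): for `g : X → B` and
`b : X_D → A_D` with `Base(g) = Base(φ) ∘ b` there is `γ : X → A` with `φ ∘ γ = g`, `Base(γ) = b`.
[cite: MochizukiFrdI2008, Def. 1.2(ii) p.22] -/
private theorem pb_exists_lift {A B X : C} {φ : A ⟶ B} (hφ : IsPullbackMorphism F φ)
    (g : X ⟶ B) (b : baseObj F X ⟶ baseObj F A) (hb : Base F g = b ≫ Base F φ) :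
    ∃ γ : X ⟶ A, γ ≫ φ = g ∧ Base F γ = b := by
  obtain ⟨γ, hγ⟩ := (hφ X).2 ⟨(g, b), hb⟩
  exact ⟨γ, congrArg (fun p : PullbackHomData F φ X => p.1.1) hγ,
    congrArg (fun p : PullbackHomData F φ X => p.1.2) hγ⟩

/-- The injectivity provided by a pull-back morphism `φ` (Def. 1.2 (ii)): arrows into its domain
are determined by their composites with `φ` and their projections to `D`.
[cite: MochizukiFrdI2008, Def. 1.2(ii) p.22] -/
private theorem pb_hom_ext {A B X : C} {φ : A ⟶ B} (hφ : IsPullbackMorphism F φ)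
    {γ γ' : X ⟶ A} (h₁ : γ ≫ φ = γ' ≫ φ) (h₂ : Base F γ = Base F γ') : γ = γ' :=
  (hφ X).1 (Subtype.ext (Prod.ext h₁ h₂))

/-- Essential surjectivity of `C^pl-bk_B → D_{B_D}` (Def. 1.3 (i)(c)), spelled out: every arrow
`f : X₀ → B_D` of `D` is, up to an isomorphism `W_D ≅ X₀`, the projection of a pull-back morphism
`ψ : W → B`. [cite: MochizukiFrdI2008, Def. 1.3(i) p.24] -/
private theorem exists_pullback_over (hF : IsFrobenioid F) (B : C) {X₀ : D}
    (f : X₀ ⟶ baseObj F B) :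
    ∃ (W : C) (ψ : W ⟶ B) (i : baseObj F W ≅ X₀), IsPullbackMorphism F ψ ∧
      Base F ψ = i.hom ≫ f := by
  haveI := hF.i_c B
  obtain ⟨P, ⟨e⟩⟩ := Functor.EssSurj.mem_essImage (pullbackSliceToBase F B) (Over.mk f)
  exact ⟨P.left.obj, P.hom.1, (Over.forget _).mapIso e, P.hom.2, (Over.w e.hom).symm⟩

/-- In a factorisation `ψ = π ∘ σ ∘ γ` with `σ`, `π` linear, `deg_Fr(γ) = deg_Fr(ψ)` (Remark 1.1.1).
[cite: MochizukiFrdI2008, Rem. 1.1.1 p.21] -/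
private theorem degFr_eq_of_factorization {A X Y B : C} {γ : A ⟶ X} {σ : X ⟶ Y} {π : Y ⟶ B}
    {ψ : A ⟶ B} (hf : γ ≫ σ ≫ π = ψ) (hσ : IsLinear F σ) (hπ : IsLinear F π) :
    degFr F γ = degFr F ψ := by
  rw [← hf, degFr_comp, degFr_comp, show degFr F σ = 1 from hσ, show degFr F π = 1 from hπ,
    mul_one, mul_one]

/-! ### Descent along morphisms of Frobenius type (the three cases of the proof of Prop. 2.1 (iii)) -/

/-- **Morphisms of Frobenius type descend** along morphisms of Frobenius type (no perfectness
needed): for `α : A → A'` and `γ' : A' → A''` of Frobenius type there are `γ : A → A₀` of Frobenius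
type with `deg_Fr(γ) = deg_Fr(γ')` and `α' : A₀ → A''` of Frobenius type with
`deg_Fr(α') = deg_Fr(α)` and `α' ∘ γ = γ' ∘ α` — "the existence and (essential) uniqueness of
morphisms of Frobenius type of a given Frobenius degree" (Def. 1.3 (ii)) applied to the two
composites of degree `deg_Fr(α) · deg_Fr(γ')` out of `A` (Prop. 1.7 (i), Remark 1.1.1).
[cite: MochizukiFrdI2008, Prop. 2.1(iii) p.44] -/
theorem exists_frobeniusType_descent (hF : IsFrobenioid F) {A A' A'' : C} {α : A ⟶ A'}
    (hα : IsFrobeniusType F α) {γ' : A' ⟶ A''} (hγ' : IsFrobeniusType F γ') :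
    ∃ (A₀ : C) (γ : A ⟶ A₀) (α' : A₀ ⟶ A''), IsFrobeniusType F γ ∧ degFr F γ = degFr F γ' ∧
      IsFrobeniusType F α' ∧ degFr F α' = degFr F α ∧ γ ≫ α' = α ≫ γ' := by
  have hP := hF.isPreFrobenioid
  obtain ⟨A₀, γ, hγ, hγd⟩ := hF.ii_exists A (degFr F γ')
  obtain ⟨A₁, δ, hδ, hδd⟩ := hF.ii_exists A₀ (degFr F α)
  obtain ⟨e, he⟩ := hF.ii_unique (γ ≫ δ) (α ≫ γ') (IsFrobeniusType.comp F hF hγ hδ)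
    (IsFrobeniusType.comp F hF hα hγ') (by rw [degFr_comp, degFr_comp, hγd, hδd, mul_comm])
  refine ⟨A₀, γ, δ ≫ e.hom, hγ, hγd,
    IsFrobeniusType.comp F hF hδ (isFrobeniusType_of_isIso F hP e.hom), ?_, ?_⟩
  · rw [degFr_comp, hδd, show degFr F e.hom = 1 from isLinear_of_isIso F e.hom, mul_one]
  · rw [← Category.assoc, he]

/-- **Pull-back morphisms descend** along morphisms of Frobenius type (no perfectness needed):
for `β : B → B'` of Frobenius type and a pull-back morphism `π' : X' → B'` there are a pull-back
morphism `π : X → B` and `φ : X → X'` of Frobenius type with `deg_Fr(φ) = deg_Fr(β)` and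
`π' ∘ φ = β ∘ π`.  Construction: `π` is a pull-back morphism over `Base(β)⁻¹ ∘ Base(π')`
(Def. 1.3 (i)(c)); `β ∘ π` is LB-invertible (Def. 1.3 (iv)(b), Prop. 1.7 (i)), hence `= π₁ ∘ φ₁`
with `φ₁` of Frobenius type and `π₁` a pull-back morphism (Prop. 1.4 (v)); the pull-back morphisms
`π₁`, `π'` into `B'` have isomorphic projections to `D_{B'_D}`, so they are isomorphic by the
isomorphism of functors defining pull-back morphisms (Def. 1.2 (ii)).
[cite: MochizukiFrdI2008, Prop. 2.1(iii) p.45] -/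
theorem exists_pullback_descent (hF : IsFrobenioid F) {B B' X' : C} {β : B ⟶ B'}
    (hβ : IsFrobeniusType F β) {π' : X' ⟶ B'} (hπ' : IsPullbackMorphism F π') :
    ∃ (X : C) (φ : X ⟶ X') (π : X ⟶ B), IsFrobeniusType F φ ∧ degFr F φ = degFr F β ∧
      IsPullbackMorphism F π ∧ π ≫ β = φ ≫ π' := by
  have hP := hF.isPreFrobenioid
  haveI : IsIso (Base F β) := hβ.2
  obtain ⟨X, π, i, hπ, hπb⟩ := exists_pullback_over hF B (Base F π' ≫ inv (Base F β))
  have hLB : IsLBInvertible F (π ≫ β) := IsLBInvertible.comp F hF (hF.iv_b π hπ).1 hβ.1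
  obtain ⟨Y, φ₁, π₁, hfac, hφ₁, hπ₁⟩ :=
    (isLBInvertible_iff_exists_factorization F hF (π ≫ β)).1 hLB
  haveI : IsIso (Base F φ₁) := hφ₁.2
  have hb : Base F φ₁ ≫ Base F π₁ = i.hom ≫ Base F π' := by
    rw [← base_comp, hfac, base_comp, hπb, Category.assoc, Category.assoc, IsIso.inv_hom_id,
      Category.comp_id]
  obtain ⟨K, hK, hKb⟩ := pb_exists_lift hπ' π₁ (inv (Base F φ₁) ≫ i.hom)
    (by rw [Category.assoc, ← hb, IsIso.inv_hom_id_assoc])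
  obtain ⟨K', hK', hK'b⟩ := pb_exists_lift hπ₁ π' (i.inv ≫ Base F φ₁)
    (by rw [Category.assoc, hb, Iso.inv_hom_id_assoc])
  have hKK' : K ≫ K' = 𝟙 Y :=
    pb_hom_ext hπ₁ (by rw [Category.assoc, hK', hK, Category.id_comp])
      (by rw [base_comp, hKb, hK'b, base_id, Category.assoc, Iso.hom_inv_id_assoc,
        IsIso.inv_hom_id])
  have hK'K : K' ≫ K = 𝟙 X' :=
    pb_hom_ext hπ' (by rw [Category.assoc, hK, hK', Category.id_comp])
      (by rw [base_comp, hK'b, hKb, base_id, Category.assoc, IsIso.hom_inv_id_assoc,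
        Iso.inv_hom_id])
  haveI : IsIso K := ⟨⟨K', hKK', hK'K⟩⟩
  refine ⟨X, φ₁ ≫ K, π, IsFrobeniusType.comp F hF hφ₁ (isFrobeniusType_of_isIso F hP K), ?_, hπ,
    ?_⟩
  · have hdeg : degFr F φ₁ * degFr F π₁ = degFr F π * degFr F β := by
      rw [← degFr_comp, hfac, degFr_comp]
    rw [show degFr F π₁ = 1 from (hF.iv_b π₁ hπ₁).2, show degFr F π = 1 from (hF.iv_b π hπ).2,
      mul_one, one_mul] at hdeg
    rw [degFr_comp, show degFr F K = 1 from isLinear_of_isIso F K, mul_one, hdeg]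
  · rw [Category.assoc, hK, hfac]

/-- **Uniqueness of the pull-back descent**: for a base-isomorphism `β : B → B'`, a pull-back
morphism `π' : X' → B'` and two pull-back morphisms `πᵢ : Xᵢ → B` with base-isomorphisms
`φᵢ : Xᵢ → X'` such that `β ∘ πᵢ = π' ∘ φᵢ`, there is an isomorphism `κ : X₁ ⥲ X₂` with
`π₂ ∘ κ = π₁` and `φ₂ ∘ κ = φ₁` — formal from the isomorphism of functors defining pull-back
morphisms (Def. 1.2 (ii)). [cite: MochizukiFrdI2008, Prop. 2.1(iii) p.45] -/
theorem pullback_descent_unique {B B' X' X₁ X₂ : C} {β : B ⟶ B'} (hβ : IsBaseIso F β)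
    {π' : X' ⟶ B'} (hπ' : IsPullbackMorphism F π')
    {φ₁ : X₁ ⟶ X'} {π₁ : X₁ ⟶ B} (hφ₁ : IsBaseIso F φ₁) (hπ₁ : IsPullbackMorphism F π₁)
    (h₁ : π₁ ≫ β = φ₁ ≫ π')
    {φ₂ : X₂ ⟶ X'} {π₂ : X₂ ⟶ B} (hφ₂ : IsBaseIso F φ₂) (hπ₂ : IsPullbackMorphism F π₂)
    (h₂ : π₂ ≫ β = φ₂ ≫ π') :
    ∃ κ : X₁ ≅ X₂, κ.hom ≫ π₂ = π₁ ∧ κ.hom ≫ φ₂ = φ₁ := by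
  haveI : IsIso (Base F β) := hβ
  haveI : IsIso (Base F φ₁) := hφ₁
  haveI : IsIso (Base F φ₂) := hφ₂
  have hb₁ : Base F π₁ = Base F φ₁ ≫ Base F π' ≫ inv (Base F β) := by
    rw [← Category.assoc, ← base_comp, ← h₁, base_comp, Category.assoc, IsIso.hom_inv_id,
      Category.comp_id]
  have hb₂ : Base F π₂ = Base F φ₂ ≫ Base F π' ≫ inv (Base F β) := by
    rw [← Category.assoc, ← base_comp, ← h₂, base_comp, Category.assoc, IsIso.hom_inv_id,
      Category.comp_id]
  obtain ⟨κ, hκ, hκb⟩ := pb_exists_lift hπ₂ π₁ (Base F φ₁ ≫ inv (Base F φ₂))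
    (by rw [hb₁, hb₂, Category.assoc, IsIso.inv_hom_id_assoc])
  obtain ⟨κ', hκ', hκ'b⟩ := pb_exists_lift hπ₁ π₂ (Base F φ₂ ≫ inv (Base F φ₁))
    (by rw [hb₂, hb₁, Category.assoc, IsIso.inv_hom_id_assoc])
  have h1 : κ ≫ κ' = 𝟙 X₁ :=
    pb_hom_ext hπ₁ (by rw [Category.assoc, hκ', hκ, Category.id_comp])
      (by rw [base_comp, hκb, hκ'b, base_id, Category.assoc, IsIso.inv_hom_id_assoc,
        IsIso.hom_inv_id])
  have h2 : κ' ≫ κ = 𝟙 X₂ :=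
    pb_hom_ext hπ₂ (by rw [Category.assoc, hκ, hκ', Category.id_comp])
      (by rw [base_comp, hκ'b, hκb, base_id, Category.assoc, IsIso.inv_hom_id_assoc,
        IsIso.hom_inv_id])
  refine ⟨⟨κ, κ', h1, h2⟩, hκ, ?_⟩
  refine pb_hom_ext hπ' ?_ ?_
  · rw [Category.assoc, ← h₂, ← Category.assoc, hκ, h₁]
  · rw [base_comp, hκb, Category.assoc, IsIso.inv_hom_id, Category.comp_id]

/-! ### Descent in a Frobenioid of perfect type (the fullness and faithfulness halves of Prop. 2.1 (iii)) -/

/-- **Fullness, generalised** ("one may reduce to the case of linear morphisms … one may reduce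
further to the case of pre-steps. But the case of pre-steps follows immediately from the definition
of perfect", pp. 44–45): in a Frobenioid of perfect type, for `α : A → A'`, `β : B → B'` of
Frobenius type of the same degree, every `ψ' : A' → B'` descends to some `ψ : A → B` with
`β ∘ ψ = ψ' ∘ α`. [cite: MochizukiFrdI2008, Prop. 2.1(iii) p.44] -/
theorem exists_descent (hF : IsFrobenioid F) (hP : IsOfPerfectType F) {A B A' B' : C}
    {α : A ⟶ A'} {β : B ⟶ B'} (hα : IsFrobeniusType F α) (hβ : IsFrobeniusType F β)
    (hd : degFr F α = degFr F β) (ψ' : A' ⟶ B') : ∃ ψ : A ⟶ B, ψ ≫ β = α ≫ ψ' := by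
  obtain ⟨A'', X', γ', σ', π', hfac, hγ', hσ', hπ'⟩ := hF.iv_a_exists ψ'
  obtain ⟨A₀, γ, α', -, -, hα', hα'd, hsq₁⟩ := exists_frobeniusType_descent hF hα hγ'
  obtain ⟨X, φ, π, hφ, hφd, -, hsq₂⟩ := exists_pullback_descent hF hβ hπ'
  haveI : IsIso (Base F α') := hα'.2
  haveI : IsIso (Base F σ') := hσ'.2
  haveI : IsIso (Base F φ) := hφ.2
  have hBX : BaseIsomorphic F A₀ X :=
    ⟨asIso (Base F α') ≪≫ asIso (Base F σ') ≪≫ (asIso (Base F φ)).symm⟩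
  obtain ⟨σ, ⟨-, hsq₃⟩, -⟩ := (hP A₀ (degFr F α)).2 α' φ ⟨Iso.refl _⟩ hBX hα' hα'd hφ
    (hφd.trans hd.symm) σ' hσ'
  refine ⟨γ ≫ σ ≫ π, ?_⟩
  calc (γ ≫ σ ≫ π) ≫ β = γ ≫ σ ≫ (π ≫ β) := by simp only [Category.assoc]
    _ = γ ≫ (σ ≫ φ) ≫ π' := by rw [hsq₂]; simp only [Category.assoc]
    _ = (γ ≫ α') ≫ σ' ≫ π' := by rw [hsq₃]; simp only [Category.assoc]
    _ = α ≫ ψ' := by rw [hsq₁, Category.assoc, hfac]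

/-- **Faithfulness, generalised**: in a Frobenioid of perfect type a morphism of Frobenius type
`β : B → B'` is right-cancellable, `β ∘ ψ₁ = β ∘ ψ₂ ⇒ ψ₁ = ψ₂`.  Along the printed reduction: factor
`ψᵢ` (Def. 1.3 (iv)(a)), push the pull-back and pre-step parts past `β` (Prop. 1.4 (v),
Prop. 1.10 (ii)), compare the two resulting factorisations of `β ∘ ψ₁` (Def. 1.3 (iv)(a),
uniqueness), identify the Frobenius-type parts by the essential uniqueness of Def. 1.3 (ii) and
total epimorphicity, the pull-back parts by `pullback_descent_unique`, and the pre-step parts by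
the uniqueness clause of "perfect" (Def. 1.2 (iv)). [cite: MochizukiFrdI2008, Prop. 2.1(iii) p.44] -/
theorem cancel_frobeniusType (hF : IsFrobenioid F) (hP : IsOfPerfectType F) {A B B' : C}
    {β : B ⟶ B'} (hβ : IsFrobeniusType F β) {ψ₁ ψ₂ : A ⟶ B} (h : ψ₁ ≫ β = ψ₂ ≫ β) :
    ψ₁ = ψ₂ := by
  have hP' := hF.isPreFrobenioid
  -- factor `ψᵢ = πᵢ ∘ σᵢ ∘ γᵢ` (Def. 1.3 (iv)(a))
  obtain ⟨A₁, X₁, γ₁, σ₁, π₁, hf₁, hγ₁, hσ₁, hπ₁⟩ := hF.iv_a_exists ψ₁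
  obtain ⟨A₂, X₂, γ₂, σ₂, π₂, hf₂, hγ₂, hσ₂, hπ₂⟩ := hF.iv_a_exists ψ₂
  -- push the pull-back parts past `β`: `β ∘ πᵢ = πᵢ' ∘ φᵢ` (Prop. 1.4 (v))
  obtain ⟨X₁', φ₁, π₁', hg₁, hφ₁, hπ₁'⟩ := (isLBInvertible_iff_exists_factorization F hF
    (π₁ ≫ β)).1 (IsLBInvertible.comp F hF (hF.iv_b π₁ hπ₁).1 hβ.1)
  obtain ⟨X₂', φ₂, π₂', hg₂, hφ₂, hπ₂'⟩ := (isLBInvertible_iff_exists_factorization F hF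
    (π₂ ≫ β)).1 (IsLBInvertible.comp F hF (hF.iv_b π₂ hπ₂).1 hβ.1)
  have hφ₁d : degFr F φ₁ = degFr F β := by
    have e := congrArg (degFr F) hg₁
    rwa [degFr_comp, degFr_comp, show degFr F π₁' = 1 from (hF.iv_b π₁' hπ₁').2,
      show degFr F π₁ = 1 from (hF.iv_b π₁ hπ₁).2, mul_one, one_mul] at e
  have hφ₂d : degFr F φ₂ = degFr F β := by
    have e := congrArg (degFr F) hg₂
    rwa [degFr_comp, degFr_comp, show degFr F π₂' = 1 from (hF.iv_b π₂' hπ₂').2,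
      show degFr F π₂ = 1 from (hF.iv_b π₂ hπ₂).2, mul_one, one_mul] at e
  -- push the pre-step parts past `φᵢ`: `φᵢ ∘ σᵢ = σᵢ' ∘ μᵢ` (Prop. 1.10 (ii))
  obtain ⟨A₁', μ₁, σ₁', hμ₁, hσ₁', hs₁, hμ₁d, -⟩ :=
    exists_frobeniusType_preStep_swap hF σ₁ hσ₁ φ₁ hφ₁
  obtain ⟨A₂', μ₂, σ₂', hμ₂, hσ₂', hs₂, -, -⟩ :=
    exists_frobeniusType_preStep_swap hF σ₂ hσ₂ φ₂ hφ₂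
  -- two factorisations of `β ∘ ψ₁` as in Def. 1.3 (iv)(a)
  have hθ₁ : (γ₁ ≫ μ₁) ≫ σ₁' ≫ π₁' = ψ₁ ≫ β := by
    calc (γ₁ ≫ μ₁) ≫ σ₁' ≫ π₁' = γ₁ ≫ (μ₁ ≫ σ₁') ≫ π₁' := by simp only [Category.assoc]
      _ = γ₁ ≫ σ₁ ≫ (φ₁ ≫ π₁') := by rw [hs₁]; simp only [Category.assoc]
      _ = ψ₁ ≫ β := by rw [hg₁, ← hf₁]; simp only [Category.assoc]
  have hθ₂ : (γ₂ ≫ μ₂) ≫ σ₂' ≫ π₂' = ψ₁ ≫ β := by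
    calc (γ₂ ≫ μ₂) ≫ σ₂' ≫ π₂' = γ₂ ≫ (μ₂ ≫ σ₂') ≫ π₂' := by simp only [Category.assoc]
      _ = γ₂ ≫ σ₂ ≫ (φ₂ ≫ π₂') := by rw [hs₂]; simp only [Category.assoc]
      _ = ψ₁ ≫ β := by rw [hg₂, h, ← hf₂]; simp only [Category.assoc]
  obtain ⟨ε, δ, hε, hδ, hπ'⟩ := hF.iv_a_unique (ψ₁ ≫ β) (γ₁ ≫ μ₁) σ₁' π₁' (γ₂ ≫ μ₂) σ₂' π₂'
    hθ₁ (IsFrobeniusType.comp F hF hγ₁ hμ₁) hσ₁' hπ₁'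
    hθ₂ (IsFrobeniusType.comp F hF hγ₂ hμ₂) hσ₂' hπ₂'
  -- (a) the pull-back parts: `κ : X₁ ≅ X₂` with `π₂ ∘ κ = π₁`, `φ₂ ∘ κ = δ ∘ φ₁`
  obtain ⟨κ, hκπ, hκφ⟩ := pullback_descent_unique hβ.2 hπ₂'
    (IsBaseIso.comp F hφ₁.2 (isBaseIso_of_isIso F δ.hom)) hπ₁
    (by rw [← hg₁, hπ', Category.assoc]) hφ₂.2 hπ₂ hg₂.symm
  -- (b) the Frobenius-type parts: `γ₂ = ι ∘ γ₁` (Def. 1.3 (ii)), then cancel `γ₁`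
  have hdψ : degFr F ψ₁ = degFr F ψ₂ := by
    have e := congrArg (degFr F) h
    rw [degFr_comp, degFr_comp] at e
    exact mul_right_cancel e
  obtain ⟨ι, hι⟩ := hF.ii_unique γ₁ γ₂ hγ₁ hγ₂
    (by rw [degFr_eq_of_factorization hf₁ hσ₁.1 (hF.iv_b π₁ hπ₁).2,
      degFr_eq_of_factorization hf₂ hσ₂.1 (hF.iv_b π₂ hπ₂).2, hdψ])
  have hμ : μ₁ ≫ ε.hom = ι.hom ≫ μ₂ := by
    have e := hε
    rw [← hι, Category.assoc, Category.assoc] at e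
    haveI := hP'.isTotallyEpimorphic.epi γ₁
    exact (cancel_epi γ₁).1 e
  -- (c) the pre-step parts: both `σ₂ ∘ ι` and `κ ∘ σ₁` descend `σ₂'` along `(ε ∘ μ₁, φ₂)`
  haveI : IsIso (Base F σ₂) := hσ₂.2
  haveI : IsIso (Base F ι.hom) := isBaseIso_of_isIso F ι.hom
  have hB : BaseIsomorphic F A₁ X₂ := ⟨asIso (Base F ι.hom) ≪≫ asIso (Base F σ₂)⟩
  have huniq := (hP A₁ (degFr F β)).2 (μ₁ ≫ ε.hom) φ₂ ⟨Iso.refl _⟩ hB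
    (IsFrobeniusType.comp F hF hμ₁ (isFrobeniusType_of_isIso F hP' ε.hom))
    (by rw [degFr_comp, hμ₁d, hφ₁d, show degFr F ε.hom = 1 from isLinear_of_isIso F ε.hom,
      mul_one]) hφ₂ hφ₂d σ₂' hσ₂'
  have e₁ : (ι.hom ≫ σ₂) ≫ φ₂ = (μ₁ ≫ ε.hom) ≫ σ₂' := by
    calc (ι.hom ≫ σ₂) ≫ φ₂ = ι.hom ≫ (σ₂ ≫ φ₂) := Category.assoc _ _ _
      _ = ι.hom ≫ μ₂ ≫ σ₂' := by rw [hs₂]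
      _ = (ι.hom ≫ μ₂) ≫ σ₂' := (Category.assoc _ _ _).symm
      _ = (μ₁ ≫ ε.hom) ≫ σ₂' := by rw [hμ]
  have e₂ : (σ₁ ≫ κ.hom) ≫ φ₂ = (μ₁ ≫ ε.hom) ≫ σ₂' := by
    calc (σ₁ ≫ κ.hom) ≫ φ₂ = σ₁ ≫ (κ.hom ≫ φ₂) := Category.assoc _ _ _
      _ = σ₁ ≫ φ₁ ≫ δ.hom := by rw [hκφ]
      _ = (σ₁ ≫ φ₁) ≫ δ.hom := (Category.assoc _ _ _).symm
      _ = (μ₁ ≫ σ₁') ≫ δ.hom := by rw [hs₁]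
      _ = μ₁ ≫ (σ₁' ≫ δ.hom) := Category.assoc _ _ _
      _ = μ₁ ≫ ε.hom ≫ σ₂' := by rw [hδ]
      _ = (μ₁ ≫ ε.hom) ≫ σ₂' := (Category.assoc _ _ _).symm
  have hστ : ι.hom ≫ σ₂ = σ₁ ≫ κ.hom :=
    huniq.unique ⟨IsPreStep.comp F (isPreStep_of_isIso F ι.hom) hσ₂, e₁⟩
      ⟨IsPreStep.comp F hσ₁ (isPreStep_of_isIso F κ.hom), e₂⟩
  -- (d) conclude
  calc ψ₁ = γ₁ ≫ σ₁ ≫ π₁ := hf₁.symm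
    _ = γ₁ ≫ (σ₁ ≫ κ.hom) ≫ π₂ := by rw [← hκπ]; simp only [Category.assoc]
    _ = (γ₁ ≫ ι.hom) ≫ σ₂ ≫ π₂ := by rw [← hστ]; simp only [Category.assoc]
    _ = ψ₂ := by rw [hι, hf₂]

end PreFrobenioid

end Literature.AlgebraicGeometry.Frobenioids
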